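import Summits.QuantumFields.BalabanUV.T4Continuum.Spine.CovariantAveragingTower

/-!
# T⁴ programme, spine node NE2 (U1a) — RE-BASING THE AVERAGING TOWER AT AN INTERMEDIATE LEVEL: the scale-covariant rate factor of
# T4-DAG U1a clause (L2) is bookkeeping (owner's scope note `t4/b2b-balaban-t4-ne2-p1/SCOPE-ROOTB-vs-NE2PLUS.md`, row (L2))

Tenth generation of the NE2 prover lineage P1 of the cell `pub-balaban`, file 5.  T4-DAG §0 U1a (L2): «the clean θ^j form is right for
UNIT-LATTICE objects, multi-scale kernels need the scale-covariant factor (η/L^jη)^γ = King's L^{−γk}(L^jη)^{−γ}».  In the abstract tower of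
`Spine/CovariantAveragingTower` (level types `ι k`, one-step averagings `A k`, items `X k`, one-step law with errors `e k`) an object READ AT
LEVEL `j` instead of the unit lattice is the unit-lattice object of the RE-BASED tower `k ↦ (ι (j+k), A (j+k), X (j+k))` — definitionally,
since `j + (k+1) = (j+k) + 1` in `ℕ`.  Hence:
 * **`oneStepAveragedLaw_rebase`**: the one-step law restricts to the re-based tower with errors `k ↦ e (j+k)`;
 * **`towerLimitRate_rebase`**: geometric errors `C·ρ^k` give `TowerLimitRate (k ↦ A (j+k)) r (k ↦ X (j+k)) (C·ρ^j) ρ` — the images on the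
   level-`j` lattice converge with `‖· − lim‖ ≤ (Cρ^j)·ρ^k/(1 − ρ)`: for `ρ = L⁻¹`, `η = L^{−(j+k)}` this is `C·L^{−(j+k)}·(L^jη)^{−1}·…` — exactly
   King's scale-covariant form with `γ = 1` (`T4EtaRate.rateFactor_eq_king`), at no cost beyond re-indexing.
So clause (L2) asks nothing new of the resolvent route: every `OneStepAveragedLaw`/`PerturbationLaws` instance of the cell yields the level-`j`
statements by this file.

HONEST FRAMING (T4-DAG p. 1).  [folklore] re-indexing; no estimate; NOT a statement about Bałaban's multi-scale kernels `G_k(x, y)` themselves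
(their identification with re-based unit-lattice images is the dictionary's business); NE2 NOT proved; spine 0/9; NOT infinite volume / mass gap
/ Clay.  HONEST DEPENDENCY: continuum YM on T⁴ ⇐ BetaPertH ∧ nine spine estimates (0/9 proved); BetaPertH ⇐ (D1) ∧ (D4) ∧ CAP+tail; G-an2-4
gates asym, D1 and NE2/3/4.  ABSOLUTE RULE kept; no `sorry`.
-/

noncomputable section

open scoped Matrix Matrix.Norms.L2Operator
open Filter Topology

namespace Summit.QuantumFields.BalabanUV.T4Continuum.TowerRebase

open Summit.QuantumFields.BalabanUV.T4Continuum.CovariantAveragingTower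

variable {ι : ℕ → Type*} [∀ k, Fintype (ι k)] [∀ k, DecidableEq (ι k)]
variable {A : (k : ℕ) → Matrix (ι k) (ι (k + 1)) ℂ} {r : ℝ} {X : (k : ℕ) → Matrix (ι k) (ι k) ℂ} {e : ℕ → ℝ}

/-- **the one-step averaged law restricts to the tower re-based at level `j`.** [folklore] -/
theorem oneStepAveragedLaw_rebase (j : ℕ) (h : OneStepAveragedLaw A r X e) :
    OneStepAveragedLaw (ι := fun k => ι (j + k)) (fun k => A (j + k)) r (fun k => X (j + k)) (fun k => e (j + k)) :=
  fun k => h (j + k)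

/-- **RE-BASED TOWER LIMIT WITH RATE**: geometric one-step errors `C·ρ^k` on the whole tower give, for the tower re-based at level `j`,
`TowerLimitRate (k ↦ A (j+k)) r (k ↦ X (j+k)) (C·ρ^j) ρ` — the level-`j` images converge with constant `C·ρ^j` (King's scale-covariant factor,
γ = 1). [cite: King1986, Lemma 4.5 (4.38) p.674 (shape L^{−γk}(L^jη)^{−γ})] [folklore] -/
theorem towerLimitRate_rebase (hr : 0 < r) (hA : ∀ k, ‖A k‖ ^ 2 ≤ r⁻¹) {C ρ : ℝ} (hρ1 : ρ < 1) (j : ℕ)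
    (hlaw : OneStepAveragedLaw A r X (fun k => C * ρ ^ k)) :
    TowerLimitRate (ι := fun k => ι (j + k)) (fun k => A (j + k)) r (fun k => X (j + k)) (C * ρ ^ j) ρ := by
  refine towerLimitRate_of_oneStepAveragedLaw (ι := fun k => ι (j + k)) (fun k => A (j + k)) hr (fun k => hA (j + k))
    (fun k => X (j + k)) hρ1 fun k => ?_
  have h := hlaw (j + k)
  dsimp only at h ⊢
  rw [pow_add] at h
  exact h.trans (le_of_eq (by ring))

/-- the same read as an explicit bound: the level-`j` images of the tower satisfy `‖c^{(j)}_k − c^{(j)}_∞‖ ≤ C·ρ^j·ρ^k/(1 − ρ)`. [folklore] -/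
theorem rebased_rate (hr : 0 < r) (hA : ∀ k, ‖A k‖ ^ 2 ≤ r⁻¹) {C ρ : ℝ} (hρ1 : ρ < 1) (j : ℕ)
    (hlaw : OneStepAveragedLaw A r X (fun k => C * ρ ^ k)) :
    ∃ Xlim : Matrix (ι (j + 0)) (ι (j + 0)) ℂ,
      Tendsto (avgTow (ι := fun k => ι (j + k)) (fun k => A (j + k)) r (fun k => X (j + k))) atTop (𝓝 Xlim) ∧
      ∀ k, ‖avgTow (ι := fun k => ι (j + k)) (fun k => A (j + k)) r (fun k => X (j + k)) k - Xlim‖ ≤ C * ρ ^ j * ρ ^ k / (1 - ρ) :=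
  towerLimitRate_rebase hr hA hρ1 j hlaw

end Summit.QuantumFields.BalabanUV.T4Continuum.TowerRebase

end
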